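import Literature.MathematicalPhysics.QuantumFieldTheory.BalabanBanachStep
import HarnessLib

/-!
# The perfect-action regulator chart for Bałaban's renormalisation step (hypothesis structure)

`RegulatorChart G r M` is a HYPOTHESIS STRUCTURE (in the manner of `BalabanBanachStep G r M` of this directory:
data + the properties consumers use, NO existence claim inside). It posits ONE complete block-averaging step of
four-dimensional pure lattice gauge theory (compact gauge group `G`, Wilson action in the faithful unitary
representation `r`, block factor `M`) as a `C¹` map of a FIXED real Banach chart `ℝ × E` on the HALF-chart
`g ∈ [0, δ]`, centred at the perfect action — the Gaussian fixed point of the block-spin map at zero coupling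
[Balaban1984Propagators: the limiting averaged quadratic form; GawedzkiKupiainen1980: the block-spin fixed point] —
so that `Ψ 0 0 = 0` and `A = D_yΨ(0,0)` is the linearised Gaussian renormalisation group, with the parabolic
derivative bounds `∂_g φ = 1 + 3 b₀ log M · g² + O(g²(g + ‖y‖))`, `∂_y φ = O(g³)`, `D_yΨ = A + O(g + ‖y‖)`,
`∂_g Ψ = O(g + ‖y‖)` (`SmoothHalfChart`), the Wilson arc `g ↦ (g, yW g)` in the basin with the bare-coupling
dictionary `betaOf g = κ/g² + O(1)` of `BalabanBanachStep`, and curvature `n`-point chart functions `corr` that are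
exactly covariant under the step INSIDE the chart, equal to `wilsonCentredSchwinger r.ρ (betaOf g) L 1 curvatureⁿ`
at the arc, and continuous on the chart for off-diagonal tuples (`ChartRealisationData`). The intended instance
puts the large-field regulator INTO THE NORM of `E` (a weighted sup-norm on polymer activities in the rescaled
Lie-algebra field whose regulator is the perfect quadratic form, as in the renormalisation-group-as-Banach-dynamics
constructions of [BauerschmidtBrydgesSlade2019RG]) instead of Bałaban's sharp small/large-field characteristic
functions and `R`-operation [Balaban1988Convergent, Thm. 1 p. 262 with the second remark "RT transforms the space
with the index k into the space with the index k + 1"; Balaban1989LargeFieldII; Dimock2013 §2.1 for the scalar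
re-exposition].

This file is the vocabulary of the line `perfect-action-regulator-chart` for the crux `BalabanStepParabolic` of
route `ParabolicTrajectory` (`YangMills`): its two chart-level bridges — a `SmoothHalfChart` yields the verbatim
Lipschitz hypothesis block `ParabolicBlock` / `BasinBlock` of `BalabanBanachStep` for the odd/even extension (mean
value inequalities), and `ChartRealisationData` yields the realisation block (4a)–(4c) of `BalabanBanachStep`
(injectivise the step on `E × (ℝ × E)`, kill non-curvature species) — are proved Summits-side; the statement
`∀ G r, ∃ M₀, ∀ M ≥ M₀, Nonempty (RegulatorChart G r M)` is the line's load-bearing stub (open, NOT asserted here; it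
implies the crux and carries its content: `corr_continuousOn` at accumulation points of Wilson orbits is a
continuum-type limit of genuine Wilson plaquette correlators along the inhabitant's tuning).

## Contents

1. `ParabolicBlock E φ Ψ A b C δ` — the hypothesis block of the route decl `ParabolicCentreCurve` (fields
   `remainder`, `lipschitz_fibre`, `lipschitz_base` of `BalabanBanachStep`) as ONE predicate over abstract data;
   `BasinBlock E φ Ψ b C δ R θ'` — the basin clauses (`contraction`, `remainder_basin`).
2. `SmoothHalfChart E φ Ψ A φg φy Ψg Ψy b C δ R θ'` — the smooth half-chart normal form (separate partial
   derivatives within `[0, δ]` / the balls, parabolic derivative bounds, fixed-point normalisations).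
3. `ChartRealisationData G r M E φ Ψ δ R yW g₀ betaOf κ K corr` (+ `.congr`) — the observable side, curvature
   strings only, inside-chart covariance, arc identification, chart continuity.
4. `RegulatorChart G r M` — the posited object bundling (1)–(3) with `b = b₀ log M`, `‖A‖ ≤ θ < 1`, `θ' < 1`.

## What is NOT here

No existence statement, no value of `b₀`, no polymer norm, no claim about Wilson's theory: all of that is the burden
of whoever inhabits the structure. No negative couplings: the half-chart is `g ≥ 0` (the odd/even extension is made
by the consumer).
-/

open scoped SchwartzMap
open _root_.MeasureTheory _root_.Filter _root_.Topology
open Literature.MathematicalPhysics.AQFT Literature.MathematicalPhysics.QuantumLattice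
open Literature.Probability.LatticeModels

noncomputable section

namespace Literature.MathematicalPhysics.QuantumFieldTheory

/-! ### 1. Chart-level predicates (pure Banach-space notions) -/

section Chart

variable (E : Type) [NormedAddCommGroup E] [NormedSpace ℝ E]

/-- **The verbatim hypothesis block of `ParabolicCentreCurve`** (fields `remainder`,
`lipschitz_fibre`, `lipschitz_base` of `BalabanBanachStep`, in that order) for the data
`(φ, Ψ, A, b, C, δ)`, on the two-sided chart `|g| ≤ δ`, `‖y‖ ≤ δ`. [folklore] -/
def ParabolicBlock (φ : ℝ → E → ℝ) (Ψ : ℝ → E → E) (A : E →L[ℝ] E) (b C δ : ℝ) : Prop :=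
  (∀ g : ℝ, ∀ y : E, |g| ≤ δ → ‖y‖ ≤ δ →
    |φ g y - (g + b * g ^ 3)| ≤ C * (g ^ 4 + |g| ^ 3 * ‖y‖) ∧
      ‖Ψ g y - A y‖ ≤ C * (g ^ 2 + ‖y‖ ^ 2)) ∧
  (∀ g : ℝ, ∀ y y' : E, |g| ≤ δ → ‖y‖ ≤ δ → ‖y'‖ ≤ δ →
    |φ g y - φ g y'| ≤ C * |g| ^ 3 * ‖y - y'‖ ∧
      ‖Ψ g y - Ψ g y' - A (y - y')‖ ≤ C * (|g| + ‖y‖ + ‖y'‖) * ‖y - y'‖) ∧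
  (∀ g g' : ℝ, ∀ y : E, |g| ≤ δ → |g'| ≤ δ → ‖y‖ ≤ δ →
    |φ g y - φ g' y - (g - g') - b * (g ^ 3 - g' ^ 3)| ≤
        C * (max |g| |g'|) ^ 2 * (max |g| |g'| + ‖y‖) * |g - g'| ∧
      ‖Ψ g y - Ψ g' y‖ ≤ C * (|g| + |g'| + ‖y‖) * |g - g'|)

/-- **The basin clauses** (fields `contraction`, `remainder_basin` of `BalabanBanachStep`):
uniform fibre contraction with rate `θ'` and the parabolic remainder bound for `φ`, both on the
big ball `‖y‖ ≤ R`, `|g| ≤ δ`. [folklore] -/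
def BasinBlock (φ : ℝ → E → ℝ) (Ψ : ℝ → E → E) (b C δ R θ' : ℝ) : Prop :=
  (∀ g : ℝ, ∀ y y' : E, |g| ≤ δ → ‖y‖ ≤ R → ‖y'‖ ≤ R → ‖Ψ g y - Ψ g y'‖ ≤ θ' * ‖y - y'‖) ∧
  (∀ g : ℝ, ∀ y : E, |g| ≤ δ → ‖y‖ ≤ R →
    |φ g y - (g + b * g ^ 3)| ≤ C * (g ^ 4 + |g| ^ 3 * ‖y‖))

/-- **Smooth half-chart normal form** — what the regulator chart is claimed to deliver: on the
HALF-chart `g ∈ [0, δ]` (no negative couplings) the coupling map `φ` and the fibre map `Ψ` have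
SEPARATE partial derivatives `φg = ∂_g φ`, `φy = ∂_y φ`, `Ψg = ∂_g Ψ`, `Ψy = D_y Ψ` (within the
interval / the balls) obeying the parabolic derivative bounds
`|∂_g φ − (1 + 3 b g²)| ≤ C g²(g + ‖y‖)` (on the basin), `‖∂_y φ‖ ≤ C g³`, `‖∂_g Ψ‖ ≤ C(g + ‖y‖)`,
`‖D_yΨ − A‖ ≤ C(g + ‖y‖)` (on the chart ball; at the origin this says `D_yΨ(0,0) = A`: the chart
is centred at the fixed point and `A` is its linearisation), the fibre contraction `‖D_yΨ‖ ≤ θ'`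
on the basin, and the fixed-point normalisations `φ 0 y = 0` (zero coupling is invariant: the
Gaussian theory stays Gaussian), `Ψ 0 0 = 0` (the perfect action is fixed). No joint `C¹` is
required: every mean-value argument of the Lipschitz bridge moves along a segment in ONE
variable. [folklore] -/
structure SmoothHalfChart (φ : ℝ → E → ℝ) (Ψ : ℝ → E → E) (A : E →L[ℝ] E)
    (φg : ℝ → E → ℝ) (φy : ℝ → E → (E →L[ℝ] ℝ)) (Ψg : ℝ → E → E) (Ψy : ℝ → E → (E →L[ℝ] E))
    (b C δ R θ' : ℝ) : Prop where
  δ_pos : 0 < δ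
  δ_le_R : δ ≤ R
  C_nonneg : 0 ≤ C
  θ'_nonneg : 0 ≤ θ'
  φ_zero : ∀ y : E, ‖y‖ ≤ R → φ 0 y = 0
  Ψ_zero_zero : Ψ 0 0 = 0
  hasDeriv_φ : ∀ g ∈ Set.Icc (0 : ℝ) δ, ∀ y : E, ‖y‖ ≤ R →
    HasDerivWithinAt (fun t : ℝ => φ t y) (φg g y) (Set.Icc 0 δ) g
  hasFDeriv_φ : ∀ g ∈ Set.Icc (0 : ℝ) δ, ∀ y : E, ‖y‖ ≤ δ →
    HasFDerivWithinAt (φ g) (φy g y) (Metric.closedBall 0 δ) y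
  hasDeriv_Ψ : ∀ g ∈ Set.Icc (0 : ℝ) δ, ∀ y : E, ‖y‖ ≤ δ →
    HasDerivWithinAt (fun t : ℝ => Ψ t y) (Ψg g y) (Set.Icc 0 δ) g
  hasFDeriv_Ψ : ∀ g ∈ Set.Icc (0 : ℝ) δ, ∀ y : E, ‖y‖ ≤ R →
    HasFDerivWithinAt (Ψ g) (Ψy g y) (Metric.closedBall 0 R) y
  φg_bound : ∀ g ∈ Set.Icc (0 : ℝ) δ, ∀ y : E, ‖y‖ ≤ R →
    |φg g y - (1 + 3 * b * g ^ 2)| ≤ C * g ^ 2 * (g + ‖y‖)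
  φy_bound : ∀ g ∈ Set.Icc (0 : ℝ) δ, ∀ y : E, ‖y‖ ≤ δ → ‖φy g y‖ ≤ C * g ^ 3
  Ψg_bound : ∀ g ∈ Set.Icc (0 : ℝ) δ, ∀ y : E, ‖y‖ ≤ δ → ‖Ψg g y‖ ≤ C * (g + ‖y‖)
  Ψy_sub_A : ∀ g ∈ Set.Icc (0 : ℝ) δ, ∀ y : E, ‖y‖ ≤ δ → ‖Ψy g y - A‖ ≤ C * (g + ‖y‖)
  Ψy_bound : ∀ g ∈ Set.Icc (0 : ℝ) δ, ∀ y : E, ‖y‖ ≤ R → ‖Ψy g y‖ ≤ θ'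

end Chart

/-! ### 2. Chart observables and the posited chart structure -/

section Structures

variable (G : Type) [Group G] [TopologicalSpace G] [IsTopologicalGroup G] [CompactSpace G]
  [MeasurableSpace G] [BorelSpace G] (r : LatticeRep G) (M : ℕ)

section Realisation

variable (E : Type) [NormedAddCommGroup E]

/-- **Chart realisation data** (the observable side, CURVATURE STRINGS ONLY, on the chart only):
the Wilson arc `g ↦ (g, yW g)`, `g ∈ [0, g₀]`, `g₀ ≤ δ`, continuous with values in the basin, the
bare-coupling dictionary `betaOf g = κ/g² + O(1)` exactly as in `BalabanBanachStep`, and the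
renormalised curvature `n`-point functions `corr p S n f` (species `r.curvature` in every slot,
multiplicative normalisation `1`, exact centring) of the effective unit-lattice theory `p` on the
torus of `S` sites, required to be
(i) exactly RG-covariant under the step for chart points WHOSE IMAGE STAYS IN THE CHART
(`corr_step`; nothing is asked where the orbit leaves `[0, δ] × B̄_R`),
(ii) equal to Wilson's centred curvature `n`-point functions AT THE ARC (`corr_wilson`, `k = 0`
only — no transport along orbits is presupposed), and
(iii) continuous on the chart for off-diagonal test tuples (`corr_continuousOn`, the (4c)
carrier: at accumulation points of Wilson orbits this is the continuum limit along the tuning,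
Disproof §D). Mixed species strings and out-of-chart values are manufactured by
the consumer (Summits-side bridge `RealisationFromChartObservables`). [folklore] -/
structure ChartRealisationData (φ : ℝ → E → ℝ) (Ψ : ℝ → E → E) (δ R : ℝ)
    (yW : ℝ → E) (g₀ : ℝ) (betaOf : ℝ → ℝ) (κ K : ℝ)
    (corr : ℝ × E → ℕ → (n : ℕ) → (Fin n → 𝓢(EuclideanSpace ℝ (Fin 4), ℝ)) → ℝ) : Prop where
  g₀_pos : 0 < g₀
  g₀_le_δ : g₀ ≤ δ
  continuousOn_yW : ContinuousOn yW (Set.Icc 0 g₀)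
  norm_yW_le : ∀ g ∈ Set.Icc 0 g₀, ‖yW g‖ ≤ R
  strictAntiOn_betaOf : StrictAntiOn betaOf (Set.Ioc 0 g₀)
  continuousOn_betaOf : ContinuousOn betaOf (Set.Ioc 0 g₀)
  κ_pos : 0 < κ
  betaOf_sub_le : ∀ g ∈ Set.Ioc 0 g₀, |betaOf g - κ / g ^ 2| ≤ K
  corr_step : ∀ (g : ℝ) (y : E), g ∈ Set.Icc 0 δ → ‖y‖ ≤ R →
    φ g y ∈ Set.Icc 0 δ → ‖Ψ g y‖ ≤ R →
    ∀ (S n : ℕ) (f : Fin n → 𝓢(EuclideanSpace ℝ (Fin 4), ℝ)),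
      corr (φ g y, Ψ g y) S n f = corr (g, y) (M * S) n (fun i => blockDilate M (f i))
  corr_wilson : ∀ g ∈ Set.Ioc 0 g₀,
    ∀ (L n : ℕ) (f : Fin n → 𝓢(EuclideanSpace ℝ (Fin 4), ℝ)),
      corr (g, yW g) (2 * L + 1) n f =
        wilsonCentredSchwinger r.ρ (betaOf g) L (fun _ => 1) n (fun _ => r.curvature) f
  corr_continuousOn : ∀ (S n : ℕ) (f : Fin n → 𝓢(EuclideanSpace ℝ (Fin 4), ℝ)),
    IsOffDiagonal (SchwartzMap.tensorFin n fun i => ofRealTest (f i)) →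
      ContinuousOn (fun p : ℝ × E => corr p S n f) (Set.Icc 0 δ ×ˢ Metric.closedBall 0 R)

variable {G r M E} in
/-- Realisation data only see `φ`, `Ψ` on the half-chart `g ≥ 0`: they transfer to any pair of
maps agreeing with `(φ, Ψ)` there (used to pass from the smooth half-chart maps to their odd/even
extensions in the line's composition). [folklore] -/
theorem ChartRealisationData.congr {φ φ' : ℝ → E → ℝ} {Ψ Ψ' : ℝ → E → E} {δ R : ℝ}
    {yW : ℝ → E} {g₀ : ℝ} {betaOf : ℝ → ℝ} {κ K : ℝ}
    {corr : ℝ × E → ℕ → (n : ℕ) → (Fin n → 𝓢(EuclideanSpace ℝ (Fin 4), ℝ)) → ℝ}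
    (h : ChartRealisationData G r M E φ Ψ δ R yW g₀ betaOf κ K corr)
    (hagree : ∀ g : ℝ, 0 ≤ g → ∀ y : E, φ' g y = φ g y ∧ Ψ' g y = Ψ g y) :
    ChartRealisationData G r M E φ' Ψ' δ R yW g₀ betaOf κ K corr where
  g₀_pos := h.g₀_pos
  g₀_le_δ := h.g₀_le_δ
  continuousOn_yW := h.continuousOn_yW
  norm_yW_le := h.norm_yW_le
  strictAntiOn_betaOf := h.strictAntiOn_betaOf
  continuousOn_betaOf := h.continuousOn_betaOf
  κ_pos := h.κ_pos
  betaOf_sub_le := h.betaOf_sub_le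
  corr_step := fun g y hg hy hφ hΨ S n f => by
    obtain ⟨h₁, h₂⟩ := hagree g hg.1 y
    rw [h₁] at hφ
    rw [h₂] at hΨ
    rw [h₁, h₂]
    exact h.corr_step g y hg hy hφ hΨ S n f
  corr_wilson := h.corr_wilson
  corr_continuousOn := h.corr_continuousOn

end Realisation

/-- **The perfect-action regulator chart** (this line's object; HYPOTHESIS STRUCTURE, no existence
claim inside — inhabiting it for all `M ≥ M₀(G, r)` is the load-bearing stub of the line, open). Intended instance: `E` = a
Banach space of gauge-invariant quasi-local polymer activities in the rescaled Lie-algebra field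
`U = exp(g a)`, normed by a weighted sup-norm whose large-field regulator is the perfect quadratic
form (Brydges–Yau; Bauerschmidt–Brydges–Slade 2019, with `h`-type field regulators), vacuum energy
quotiented out; the origin `(0, 0)` = the Gaussian fixed point of the block-averaging map at zero
coupling (Bałaban's limiting averaged quadratic form, CMP 95/96; Gawędzki–Kupiainen); the step
`(φ, Ψ)` = ONE exact gauge-covariant averaging step of block factor `M` (CMP 98) followed by
perturbative extraction of the marginal coordinate `g` and rescaling — no `R`-operation, no
characteristic functions — claimed `C¹` on the half-chart with the parabolic derivative bounds of
`SmoothHalfChart` (`b = b₀ log M`, `b₀ > 0` the one-loop coefficient; `A = D_yΨ(0,0)` the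
linearised Gaussian RG, `‖A‖ ≤ θ < 1` after renorming the irrelevant directions); the Wilson arc
`yW` = coordinates of Wilson's action at bare coupling `g`, continuous down to the perfect-action
endpoint `g = 0` (at `g = 0`: convergence of the averaged quadratic forms, CMP 95/96) and inside
the basin of the fibre contraction; `corr` = the renormalised curvature `n`-point functions of
the effective theories, continuous on the chart in the regulator norm (finite-volume states are
norm-continuous; observables are slaved to the action flow). The derivative maps `φg φy Ψg Ψy`
are data (the constructor knows its derivatives). [cite: Balaban1988Convergent, Thm. 1 p. 262 (second remark)] [cite: BauerschmidtBrydgesSlade2019RG, Part II (the renormalisation group map as a dynamical system on a Banach space of polymer activities)] -/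
structure RegulatorChart where
  two_le_M : 2 ≤ M
  /-- The chart. -/
  E : Type
  [instNormedAddCommGroup : NormedAddCommGroup E]
  [instNormedSpace : NormedSpace ℝ E]
  [instCompleteSpace : CompleteSpace E]
  /-- The coupling renormalisation of one exact averaging step (half-chart `g ≥ 0`). -/
  φ : ℝ → E → ℝ
  /-- The step in the irrelevant directions. -/
  Ψ : ℝ → E → E
  /-- The linearised Gaussian RG at the perfect fixed point. -/
  A : E →L[ℝ] E
  /-- `∂_g φ`. -/
  φg : ℝ → E → ℝ
  /-- `∂_y φ`. -/
  φy : ℝ → E → (E →L[ℝ] ℝ)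
  /-- `∂_g Ψ`. -/
  Ψg : ℝ → E → E
  /-- `D_y Ψ`. -/
  Ψy : ℝ → E → (E →L[ℝ] E)
  /-- One-loop coefficient (`b = b₀ log M`). -/
  b₀ : ℝ
  θ : ℝ
  C : ℝ
  δ : ℝ
  R : ℝ
  θ' : ℝ
  b₀_pos : 0 < b₀
  θ_nonneg : 0 ≤ θ
  θ_lt_one : θ < 1
  norm_A_le : ‖A‖ ≤ θ
  θ'_lt_one : θ' < 1
  /-- The smooth half-chart normal form with `b = b₀ log M`. -/
  smooth : SmoothHalfChart E φ Ψ A φg φy Ψg Ψy (b₀ * Real.log M) C δ R θ'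
  /-- The Wilson arc. -/
  yW : ℝ → E
  g₀ : ℝ
  /-- Bare inverse coupling of the chart coupling. -/
  betaOf : ℝ → ℝ
  κ : ℝ
  K : ℝ
  /-- Renormalised curvature `n`-point functions of the effective theories. -/
  corr : ℝ × E → ℕ → (n : ℕ) → (Fin n → 𝓢(EuclideanSpace ℝ (Fin 4), ℝ)) → ℝ
  /-- Wilson arc + dictionary + chart observables. -/
  realisation : ChartRealisationData G r M E φ Ψ δ R yW g₀ betaOf κ K corr

attribute [instance] RegulatorChart.instNormedAddCommGroup RegulatorChart.instNormedSpace
  RegulatorChart.instCompleteSpace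

end Structures

end Literature.MathematicalPhysics.QuantumFieldTheory

end
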